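import Summits.NavierStokesRegularity.FunctionalMining.ProfileWirtinger
import Summits.NavierStokesRegularity.FunctionalMining.StretchingLaminateDirection
import Summits.NavierStokesRegularity.FunctionalMining.PlanarShadowTopEig
import Summits.NavierStokesRegularity.FunctionalMining.TopEigHeatConvex
import Summits.NavierStokesRegularity.FunctionalMining.TopEigHeatCoerciveGap
import HarnessLib

/-!
# FunctionalMining — LAMINATES ARE RIGID for Lemma L-λ(2): every unidirectional laminate
# `u_F = (F(x₂), 0, 0)` has `heatDissipation (∫(λ₁⁺)²) u_F = ½∫₀¹F″² ≥ 8π² · ∫(λ₁⁺)²(u_F)`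

Search for candidate a priori estimates; no regularity claim. Cell `pub-nsfunc`, prove seat
(gen 19). Kernel form of the no-go seat's laminate rigidity lemma (`SIEVELD.md` §3.4b (4b)(i),
unidirectional polarisation, lamination direction `x₂`): along a one-dimensional structure the heat
dissipation of `∫λ₁²` can NOT go below the single-shell value `2·4π²`. Static calculus of explicit
smooth fields; nothing about Navier–Stokes dynamics is asserted.

For EVERY smooth `1`-periodic profile `F` (`ShearProfile`), with `u_F := lamU F = (F(x₂), 0, 0)`
(`= dirFun e₂ F • e₀`, `LaminateDirection.dirFun`):
* `lamU F` is smooth and divergence free; `Δ u_F = u_{F″}` (`laplacian_lamU`), so the heat LINE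
  `u_F + tΔu_F = u_F + t u_{F″}` stays a laminate; its strain is planar trace-free
  (`PlanarTopEig.IsPlanarTF`) with `S₀₀ = 0`, `S₀₂ = ½F′(x₂)` (`strain_lamU`), hence
  `λ(±S(u_F + tΔu_F))² = (½F′(x₂) + t·½F‴(x₂))²` (`lam_sq_line`);
* `topEigMoment_two_line` — `∫(λ₁⁺)²(u_F + tΔu_F) = ¼∫₀¹F′² + (t/2)∫₀¹F′F‴ + (t²/4)∫₀¹F‴²`
  (Lemma D `LaminateDirection.integral_comp_dirForm`), in particular `∫(λ₁⁺)²(u_F) = ¼∫₀¹F′²`;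
* `heatDissipation_topEigMoment_two_lamU` — **`heatDissipation (∫(λ₁⁺)²) u_F = ½∫₀¹F″²`**
  (convexity calibration `TopEig.heatDissipation_topEigMoment_eq` + integration by parts
  `∫₀¹F′F‴ = −∫₀¹F″²`);
* **`laminate_rigid_two : 8π² · ∫(λ₁⁺)²(u_F) ≤ heatDissipation (∫(λ₁⁺)²) u_F`** — by the sharp
  Wirtinger inequality `4π²∫F′² ≤ ∫F″²` (`ProfileWirtinger.wirtinger_D`); i.e. `R₂(u_F) ≥ 2·4π²`, the
  single-shell value, for every laminate (equality for a single Fourier mode, `TopEigHeatCoerciveRate`);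
  the same for the `−λ₃` core; in the dictionary's class vocabulary (`TopEigHeatCoerciveGap.lean`):
  **`heatCoerciveOn_laminate_two : HeatCoerciveOn IsX2Laminate (∫(λ₁⁺)²) (8π²)`**.
Contrast (`TopEigLaminateFour`): at `q = 4` a two-mode laminate already goes BELOW the shell value
(`R₄ = (2637/2957)·16π²`); so rigidity of one-dimensional structure is special to `q = 2`, and any field
with `R₂ < 2·4π²` (nogo descent: `inf R₂ ≤ 0.58·4π²`, numerical) is NOT a laminate. [ours, calibration]
-/

noncomputable section

open MeasureTheory Set intervalIntegral

namespace Summit.NavierStokesRegularity.FunctionalMining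

open Literature.Analysis Literature.Analysis.FunctionSpaces Literature.Analysis.FunctionSpaces.Torus
open TopEig PlanarTopEig StrainL4 LaminateDirection

namespace TopEigLaminate

/-! ## 1. The laminate `u_F = (F(x₂), 0, 0)` for a general smooth periodic profile -/

/-- The lamination direction `e₂ = (0,0,1) ∈ ℤ³`. [ours; bookkeeping] -/
def e2 : Fin 3 → ℤ := ![0, 0, 1]

/-- Components of `e₂`. [ours; bookkeeping] -/
@[simp] theorem e2_apply (j : Fin 3) : (e2 j : ℝ) = if j = 2 then 1 else 0 := by
  fin_cases j <;> simp [e2]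

/-- `e₂ ≠ 0`. [ours; bookkeeping] -/
theorem e2_ne_zero : e2 ≠ 0 := by
  intro h
  have := congrFun h 2
  simp [e2] at this

/-- **The laminate `u_F(x) = F(x₂) · e₀`.** Search for candidate a priori estimates; no regularity
claim. [ours] -/
def lamU (F : ShearProfile) (x : UnitAddTorus (Fin 3)) : EuclideanSpace ℝ (Fin 3) :=
  dirFun e2 F x • EuclideanSpace.single 0 (1 : ℝ)

variable (F : ShearProfile)

/-- `u_F` is smooth. [ours] -/
theorem isSmooth_lamU : IsSmooth (lamU F) := (isSmooth_dirFun e2 F).smul' (isSmooth_const _)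

/-- `u_F` is `C¹`. [ours; bookkeeping] -/
theorem isContDiff_lamU : IsContDiff 1 (lamU F) := (isSmooth_lamU F).isContDiff (by simp)

/-- **`∂ⱼ u_F = [j = 2] · u_{F′}`** (function level). [ours] -/
theorem partialDeriv_lamU (j : Fin 3) :
    Torus.partialDeriv j (lamU F) = (if j = 2 then (1 : ℝ) else 0) • lamU F.D := by
  funext x
  rw [show lamU F = fun y => dirFun e2 F y • EuclideanSpace.single 0 (1 : ℝ) from rfl,
    partialDeriv_smul' (isContDiff_dirFun e2 F) ((isSmooth_const _).isContDiff (by simp)),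
    show Torus.partialDeriv j (fun _ : UnitAddTorus (Fin 3) => EuclideanSpace.single (0 : Fin 3) (1 : ℝ)) x = 0 by
      unfold Torus.partialDeriv Torus.lineDeriv; simp,
    smul_zero, add_zero, partialDeriv_dirFun, e2_apply, Pi.smul_apply, lamU, smul_smul]

/-- Coordinates: `(∂ⱼu_F)ᵢ(x) = [j = 2][i = 0] F′(x₂)`. [ours] -/
theorem partialDeriv_lamU_apply (j i : Fin 3) (x : UnitAddTorus (Fin 3)) :
    Torus.partialDeriv j (lamU F) x i =
      (if j = 2 then (1 : ℝ) else 0) * ((if i = 0 then (1 : ℝ) else 0) * dirFun e2 F.D x) := by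
  rw [partialDeriv_lamU]
  simp only [Pi.smul_apply, lamU, PiLp.smul_apply, smul_eq_mul, PiLp.single_apply]
  split_ifs <;> ring

/-- **`u_F` is divergence free.** [ours] -/
theorem isDivFree_lamU : IsDivFree (lamU F) := by
  intro x
  rw [divergence_eq_sum_partialDeriv_apply (isContDiff_lamU F), Fin.sum_univ_three,
    partialDeriv_lamU_apply, partialDeriv_lamU_apply, partialDeriv_lamU_apply]
  simp

/-- **`Δ u_F = u_{F″}`.** [ours] -/
theorem laplacian_lamU : Torus.laplacian (lamU F) = lamU F.D.D := by
  funext x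
  rw [laplacian_eq_sum_partialDeriv_partialDeriv (isSmooth_lamU F), Fin.sum_univ_three]
  have h : ∀ j : Fin 3, Torus.partialDeriv j (Torus.partialDeriv j (lamU F)) =
      (if j = 2 then (1 : ℝ) else 0) • ((if j = 2 then (1 : ℝ) else 0) • lamU F.D.D) := by
    intro j
    rw [partialDeriv_lamU, partialDeriv_const_smul (isContDiff_lamU F.D), partialDeriv_lamU]
  rw [h, h, h]
  simp

/-! ## 2. The strain along the heat line is planar; `λ(±S)² = (½F′ + t·½F‴)²` -/

/-- **The strain of `u_F` is planar trace-free**, `S₀₀ = 0`, `S₀₂ = ½F′(x₂)`. [ours] -/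
theorem strain_lamU (x : UnitAddTorus (Fin 3)) :
    IsPlanarTF (strainFlat (lamU F) x) ∧ strainFlat (lamU F) x (0, 0) = 0 ∧
      strainFlat (lamU F) x (0, 2) = dirFun e2 F.D x / 2 := by
  refine ⟨⟨fun i j => strainFlat_symm _ x i j, fun j => ?_, ?_⟩, ?_, ?_⟩
  · fin_cases j <;> simp [strainFlat_apply, partialDeriv_lamU_apply]
  · simp [strainFlat_apply, partialDeriv_lamU_apply]
  · simp [strainFlat_apply, partialDeriv_lamU_apply]
  · simp [strainFlat_apply, partialDeriv_lamU_apply]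

/-- Along the heat line: `λ(S(u_F + tΔu_F))² = λ(−S(…))² = (½F′(x₂) + t·½F‴(x₂))²`, `λ(±S) ≥ 0`. [ours] -/
theorem lam_sq_line (t : ℝ) (x : UnitAddTorus (Fin 3)) :
    lam (strainFlat (lamU F + t • Torus.laplacian (lamU F)) x) ^ 2 =
        (dirFun e2 F.D x / 2 + t * (dirFun e2 F.D.D.D x / 2)) ^ 2 ∧
      lam (-strainFlat (lamU F + t • Torus.laplacian (lamU F)) x) ^ 2 =
        (dirFun e2 F.D x / 2 + t * (dirFun e2 F.D.D.D x / 2)) ^ 2 ∧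
      0 ≤ lam (strainFlat (lamU F + t • Torus.laplacian (lamU F)) x) ∧
      0 ≤ lam (-strainFlat (lamU F + t • Torus.laplacian (lamU F)) x) := by
  rw [laplacian_lamU]
  obtain ⟨h1, h100, h102⟩ := strain_lamU F x
  obtain ⟨h2, h200, h202⟩ := strain_lamU F.D.D x
  have hline := strainFlat_add_smul (isContDiff_lamU F) (isContDiff_lamU F.D.D) t x
  have hpl : IsPlanarTF (strainFlat (lamU F + t • lamU F.D.D) x) := by
    rw [hline]; exact h1.add_smul h2 t
  have h00 : strainFlat (lamU F + t • lamU F.D.D) x (0, 0) = 0 := by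
    rw [hline, PiLp.add_apply, PiLp.smul_apply, smul_eq_mul, h100, h200, mul_zero, add_zero]
  have h02 : strainFlat (lamU F + t • lamU F.D.D) x (0, 2) =
      dirFun e2 F.D x / 2 + t * (dirFun e2 F.D.D.D x / 2) := by
    rw [hline, PiLp.add_apply, PiLp.smul_apply, smul_eq_mul, h102, h202]
  have hsq : ∀ {A : EuclideanSpace ℝ (Fin 3 × Fin 3)}, IsPlanarTF A →
      lam A ^ 2 = A (0, 0) ^ 2 + A (0, 2) ^ 2 := fun hA => by
    rw [hA.lam_eq, Real.sq_sqrt (by positivity)]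
  refine ⟨?_, ?_, ?_, ?_⟩
  · rw [hsq hpl, h00, h02]; ring
  · rw [hsq hpl.neg]
    simp only [PiLp.neg_apply, h00, h02]; ring
  · rw [hpl.lam_eq]; exact Real.sqrt_nonneg _
  · rw [hpl.neg.lam_eq]; exact Real.sqrt_nonneg _

/-! ## 3. The moments along the heat line: a quadratic polynomial with profile-integral coefficients -/

/-- Lemma D for two profiles: `∫_{T³} (P(x₂)/2 + t·Q(x₂)/2)² dx = ∫₀¹ (P/2 + t·Q/2)²`. [ours] -/
theorem integral_line_sq (P Q : ShearProfile) (t : ℝ) :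
    ∫ x, (dirFun e2 P x / 2 + t * (dirFun e2 Q x / 2)) ^ 2 =
      ∫ s in (0 : ℝ)..1, (P s / 2 + t * (Q s / 2)) ^ 2 := by
  have hc : Continuous fun y : UnitAddCircle => (P.onCircle y / 2 + t * (Q.onCircle y / 2)) ^ 2 := by
    have hP := P.continuous_onCircle
    have hQ := Q.continuous_onCircle
    continuity
  have h := integral_comp_dirForm e2_ne_zero (F := fun y => (P.onCircle y / 2 + t * (Q.onCircle y / 2)) ^ 2)
    hc.aestronglyMeasurable
  simp only [dirFun] at h ⊢
  rw [h, CellularStretching.integral_circle_eq_intervalIntegral]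
  simp only [ShearProfile.onCircle_coe]

/-- The three profile integrals `A = ∫₀¹F′²`, `B = ∫₀¹F′F‴`, `C = ∫₀¹F‴²` and the expansion
`∫₀¹ (F′/2 + tF‴/2)² = A/4 + (t/2)B + (t²/4)C`. [ours] -/
theorem integral_profile_sq_expand (t : ℝ) :
    ∫ s in (0 : ℝ)..1, (F.D s / 2 + t * (F.D.D.D s / 2)) ^ 2 =
      (1 / 4) * (∫ s in (0 : ℝ)..1, F.D s ^ 2) + (t / 2) * (∫ s in (0 : ℝ)..1, F.D s * F.D.D.D s) +
        (t ^ 2 / 4) * (∫ s in (0 : ℝ)..1, F.D.D.D s ^ 2) := by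
  have e : ∀ s, (F.D s / 2 + t * (F.D.D.D s / 2)) ^ 2 =
      (1 / 4) * (F.D s ^ 2) + (t / 2) * (F.D s * F.D.D.D s) + (t ^ 2 / 4) * (F.D.D.D s ^ 2) := fun s => by ring
  simp_rw [e]
  have c1 : Continuous fun s => F.D s ^ 2 := F.D.continuous.pow 2
  have c2 : Continuous fun s => F.D s * F.D.D.D s := F.D.continuous.mul F.D.D.D.continuous
  have c3 : Continuous fun s => F.D.D.D s ^ 2 := F.D.D.D.continuous.pow 2
  have i1 : IntervalIntegrable (fun s => (1 / 4 : ℝ) * (F.D s ^ 2)) volume 0 1 :=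
    (continuous_const.mul c1).intervalIntegrable _ _
  have i2 : IntervalIntegrable (fun s => (t / 2) * (F.D s * F.D.D.D s)) volume 0 1 :=
    (continuous_const.mul c2).intervalIntegrable _ _
  have i3 : IntervalIntegrable (fun s => (t ^ 2 / 4) * (F.D.D.D s ^ 2)) volume 0 1 :=
    (continuous_const.mul c3).intervalIntegrable _ _
  rw [intervalIntegral.integral_add (i1.add i2) i3, intervalIntegral.integral_add i1 i2,
    intervalIntegral.integral_const_mul, intervalIntegral.integral_const_mul,
    intervalIntegral.integral_const_mul]

/-- **The two moments along the heat line of `u_F`**: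
`∫(λ₁⁺)²(u_F + tΔu_F) = ∫((−λ₃)⁺)²(…) = A/4 + (t/2)B + (t²/4)C`. [ours] -/
theorem topEigMoment_two_line (t : ℝ) :
    torusTopEigMoment 2 (lamU F + t • Torus.laplacian (lamU F)) =
        (1 / 4) * (∫ s in (0 : ℝ)..1, F.D s ^ 2) + (t / 2) * (∫ s in (0 : ℝ)..1, F.D s * F.D.D.D s) +
          (t ^ 2 / 4) * (∫ s in (0 : ℝ)..1, F.D.D.D s ^ 2) ∧
      torusNegBotEigMoment 2 (lamU F + t • Torus.laplacian (lamU F)) =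
        (1 / 4) * (∫ s in (0 : ℝ)..1, F.D s ^ 2) + (t / 2) * (∫ s in (0 : ℝ)..1, F.D s * F.D.D.D s) +
          (t ^ 2 / 4) * (∫ s in (0 : ℝ)..1, F.D.D.D s ^ 2) := by
  rw [← integral_profile_sq_expand, ← integral_line_sq]
  constructor
  · unfold torusTopEigMoment
    refine integral_congr_ae (ae_of_all _ fun x => ?_)
    obtain ⟨h1, -, h3, -⟩ := lam_sq_line F t x
    dsimp only
    rw [← lam_strainFlat, max_eq_left h3, Real.rpow_two, h1]
  · unfold torusNegBotEigMoment
    refine integral_congr_ae (ae_of_all _ fun x => ?_)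
    obtain ⟨-, h1, -, h4⟩ := lam_sq_line F t x
    dsimp only
    rw [← lam_neg_strainFlat, max_eq_left h4, Real.rpow_two, h1]

/-- **`∫(λ₁⁺)²(u_F) = ∫((−λ₃)⁺)²(u_F) = ¼∫₀¹F′²`.** [ours] -/
theorem topEigMoment_two_lamU :
    torusTopEigMoment 2 (lamU F) = (1 / 4) * ∫ s in (0 : ℝ)..1, F.D s ^ 2 ∧
      torusNegBotEigMoment 2 (lamU F) = (1 / 4) * ∫ s in (0 : ℝ)..1, F.D s ^ 2 := by
  have h := topEigMoment_two_line F 0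
  simpa using h

/-! ## 4. The heat dissipation: `½∫₀¹F″²` -/

/-- Integration by parts over a period: `∫₀¹ F′F‴ = −∫₀¹ F″²`. [folklore] -/
theorem integral_D_mul_DDD : ∫ s in (0 : ℝ)..1, F.D s * F.D.D.D s = -∫ s in (0 : ℝ)..1, F.D.D s ^ 2 := by
  have hd : ∀ (Q : ShearProfile) (x : ℝ), HasDerivAt (Q : ℝ → ℝ) (Q.D x) x := fun Q x =>
    ((Q.contDiff.differentiable (by simp)) x).hasDerivAt
  have h := intervalIntegral.integral_mul_deriv_eq_deriv_mul (a := 0) (b := 1)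
    (u := (F.D : ℝ → ℝ)) (v := (F.D.D : ℝ → ℝ)) (u' := (F.D.D : ℝ → ℝ)) (v' := (F.D.D.D : ℝ → ℝ))
    (fun x _ => hd F.D x) (fun x _ => hd F.D.D x) (F.D.D.continuous.intervalIntegrable _ _)
    (F.D.D.D.continuous.intervalIntegrable _ _)
  have hp1 : F.D 1 = F.D 0 := by have := F.D.periodic 0; simpa using this
  have hp2 : F.D.D 1 = F.D.D 0 := by have := F.D.D.periodic 0; simpa using this
  rw [h, hp1, hp2, sub_self, zero_sub]
  congr 1
  refine intervalIntegral.integral_congr fun s _ => ?_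
  show F.D.D s * F.D.D s = F.D.D s ^ 2
  ring

/-- **`heatDissipation (∫(λ₁⁺)²) u_F = ½∫₀¹F″²`**, and the same for the `−λ₃` core. [ours] -/
theorem heatDissipation_topEigMoment_two_lamU :
    heatDissipation (torusTopEigMoment 2) (lamU F) = (1 / 2) * ∫ s in (0 : ℝ)..1, F.D.D s ^ 2 ∧
      heatDissipation (torusNegBotEigMoment 2) (lamU F) = (1 / 2) * ∫ s in (0 : ℝ)..1, F.D.D s ^ 2 := by
  have hq : (1 : ℝ) ≤ 2 := by norm_num
  set A := ∫ s in (0 : ℝ)..1, F.D s ^ 2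
  set B := ∫ s in (0 : ℝ)..1, F.D s * F.D.D.D s
  set C := ∫ s in (0 : ℝ)..1, F.D.D.D s ^ 2
  -- derivative of the quadratic `A/4 + (t/2)B + (t²/4)C` at `0` is `B/2` (kept local)
  have hquad : HasDerivAt (fun t : ℝ => (1 / 4) * A + (t / 2) * B + (t ^ 2 / 4) * C) (B / 2) 0 := by
    have h1 : HasDerivAt (fun t : ℝ => (t / 2) * B) ((1 / 2) * B) 0 := by
      have := ((hasDerivAt_id (0 : ℝ)).div_const 2).mul_const B
      simpa using this
    have h2 : HasDerivAt (fun t : ℝ => (t ^ 2 / 4) * C) 0 0 := by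
      have := (((hasDerivAt_pow 2 (0 : ℝ))).div_const 4).mul_const C
      simpa using this
    have h := ((hasDerivAt_const (0 : ℝ) ((1 / 4) * A)).add h1).add h2
    have e : (fun t : ℝ => (1 / 4) * A + (t / 2) * B + (t ^ 2 / 4) * C) =
        (((fun _ : ℝ => (1 / 4) * A) + fun t : ℝ => (t / 2) * B) + fun t : ℝ => (t ^ 2 / 4) * C) := by
      funext t; simp only [Pi.add_apply]
    rw [e]
    exact h.congr_deriv (by ring)
  have hB : -(B / 2) = (1 / 2) * ∫ s in (0 : ℝ)..1, F.D.D s ^ 2 := by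
    simp only [B, integral_D_mul_DDD]; ring
  constructor
  · have e : (fun t : ℝ => torusTopEigMoment 2 (lamU F + t • Torus.laplacian (lamU F))) =
        fun t : ℝ => (1 / 4) * A + (t / 2) * B + (t ^ 2 / 4) * C := funext fun t => (topEigMoment_two_line F t).1
    rw [(heatDissipation_topEigMoment_eq hq (isSmooth_lamU F)).2, e,
      hquad.hasDerivWithinAt.derivWithin (uniqueDiffWithinAt_Ioi 0), hB]
  · have e : (fun t : ℝ => torusNegBotEigMoment 2 (lamU F + t • Torus.laplacian (lamU F))) =
        fun t : ℝ => (1 / 4) * A + (t / 2) * B + (t ^ 2 / 4) * C := funext fun t => (topEigMoment_two_line F t).2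
    rw [(heatDissipation_negBotEigMoment_eq hq (isSmooth_lamU F)).2, e,
      hquad.hasDerivWithinAt.derivWithin (uniqueDiffWithinAt_Ioi 0), hB]

/-! ## 5. Rigidity: `R₂(u_F) ≥ 2·4π²` for every laminate -/

/-- **LAMINATE RIGIDITY for L-λ(2)**: `8π² · ∫(λ₁⁺)²(u_F) ≤ heatDissipation (∫(λ₁⁺)²) u_F` for every
smooth `1`-periodic profile `F` — one-dimensional structure never goes below the single-shell rate
`2·4π²` (sharp Wirtinger). The same for the `−λ₃` core. [ours, calibration] -/
theorem laminate_rigid_two :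
    8 * Real.pi ^ 2 * torusTopEigMoment 2 (lamU F) ≤ heatDissipation (torusTopEigMoment 2) (lamU F) ∧
      8 * Real.pi ^ 2 * torusNegBotEigMoment 2 (lamU F) ≤
        heatDissipation (torusNegBotEigMoment 2) (lamU F) := by
  have hW := ProfileWirtinger.wirtinger_D F
  rw [(topEigMoment_two_lamU F).1, (topEigMoment_two_lamU F).2,
    (heatDissipation_topEigMoment_two_lamU F).1, (heatDissipation_topEigMoment_two_lamU F).2]
  constructor <;> nlinarith

/-- The class of unidirectional `x₂`-laminates `(F(x₂), 0, 0)`. [ours; bookkeeping] -/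
def IsX2Laminate (v : UnitAddTorus (Fin 3) → EuclideanSpace ℝ (Fin 3)) : Prop :=
  ∃ F : ShearProfile, v = lamU F

/-- **Lemma L-λ(2) HOLDS on the laminate class with the single-shell rate**:
`HeatCoerciveOn IsX2Laminate (∫(λ₁⁺)²) (8π²)` (dictionary vocabulary of `TopEigHeatCoerciveGap`).
[ours, calibration] -/
theorem heatCoerciveOn_laminate_two :
    HeatCoerciveOn (d := Fin 3) IsX2Laminate (torusTopEigMoment 2) (8 * Real.pi ^ 2) := by
  rintro - v - - - ⟨F, rfl⟩
  exact (laminate_rigid_two F).1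

/-- The `−λ₃` core: `HeatCoerciveOn IsX2Laminate (∫((−λ₃)⁺)²) (8π²)`. [ours, calibration] -/
theorem heatCoerciveOn_laminate_two_negBot :
    HeatCoerciveOn (d := Fin 3) IsX2Laminate (torusNegBotEigMoment 2) (8 * Real.pi ^ 2) := by
  rintro - v - - - ⟨F, rfl⟩
  exact (laminate_rigid_two F).2

end TopEigLaminate

end Summit.NavierStokesRegularity.FunctionalMining

end
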